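import Literature.NumberTheory.LFunctions.DedekindZetaLogDerivGRH
import HarnessLib

/-!
# The local partial fraction of `ζ_K'/ζ_K`, uniformly in the number field

Topic `Literature/NumberTheory/LFunctions` (namespace `Literature.NumberTheory.LFunctions`, continuing
`DedekindZetaLogDerivGRH.lean`). Everything in this file is PROVED; there are no named facts.

For a number field `K` (`n_K = [K : ℚ]`, discriminant `d_K`) and the entire function
`ζ₁_K(s) = (s − 1)ζ_K(s)` (`dedekindZeta₁ K`), with the disc bound
`M_K(t) = log|d_K| + 3 n_K + (n_K + 1) log(|t| + 7)` (`discBound K t`) of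
`DedekindZetaLogDerivGRH.lean`, we prove with ABSOLUTE numerical constants:

* `sum_divisor_dedekindZeta₁_bigDisc_le` — Jensen: the zeros of `ζ₁_K` in the disc
  `|s − (2 + it)| ≤ 31/16`, with multiplicity, number at most `32 M_K(t)`
  (Lagarias–Odlyzko 1977, Lemma 5.4, "`n_L(t) ≪ log d_L + n_L log(|t| + 2)`", disc form);
* `norm_logDeriv_dedekindZeta₁_sub_sum_le` — **the local partial fraction** (Lagarias–Odlyzko
  1977, Lemma 5.6: "`ζ_L'/ζ_L(s) + … = ∑_{|γ − t| ≤ 1} 1/(s − ρ) + O(ℒ(t))` for `−1/2 ≤ σ ≤ 3`",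
  here in disc form and for `ζ₁_K`, whose logarithmic derivative is `ζ_K'/ζ_K + 1/(s − 1)`): for
  every real `t` and every `s` with `|s − (2 + it)| ≤ 7/4`, `ζ₁_K(s) ≠ 0`,
  `|ζ₁_K'/ζ₁_K(s) − ∑_ρ m(ρ)/(s − ρ)| ≤ 77760 · M_K(t)`,
  the sum over the zeros `ρ` of `ζ₁_K` in `|ρ − (2 + it)| ≤ 31/16` (Landau's lemma, the tree's
  `Literature.Analysis.Complex.norm_logDeriv_sub_sum_le`, radii `7/4 < 15/8 < 31/16 < 2`, fed with
  the convexity bound `norm_dedekindZeta₁_le_of_mem_closedBall` and `|ζ₁_K(2+it)| ≥ e^{−n_K}` of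
  `DedekindZetaEntireConvexity.lean`). The disc `|s − (2+it)| ≤ 7/4` contains the segment
  `1/4 ≤ σ ≤ 15/4` at height `t`, which is what the explicit-formula contour needs;
* `zero_of_mem_support_divisor_bigDisc` — the `ρ` occurring are zeros of `ζ_K` with
  `1/16 ≤ Re ρ < 1` (so, under ERH for `K`, `Re ρ = 1/2`: `re_eq_one_half_of_mem_support_of_erh`);
* `norm_logDeriv_dedekindZeta₁_le_of_erh_of_dist` — under ERH, at distance `≥ η` from the
  critical line inside that disc, `|ζ₁_K'/ζ₁_K(s)| ≤ (32/η + 77760) M_K(t)`; in particular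
  `norm_logDeriv_dedekindZeta₁_quarter_le_of_erh`: `|ζ₁_K'/ζ₁_K(1/4 + it)| ≤ 77888 M_K(t)`.

## References

* J. C. Lagarias, A. M. Odlyzko, *Effective versions of the Chebotarev density theorem*, in:
  Algebraic Number Fields (Durham 1975), Academic Press 1977, §5, Lemmas 5.4–5.6.
  [cite: LagariasOdlyzko1977, Lemma 5.6]
* E. C. Titchmarsh, *The Theory of the Riemann Zeta-Function*, 2nd ed. (1986), §3.9 Lemma α.
  [cite: Titchmarsh1986, §3.9 Lemma α]
-/

noncomputable section

open Complex Filter Topology Set Metric MeromorphicOn NumberField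
open scoped NumberField

namespace Literature.NumberTheory.LFunctions

variable (K : Type*) [Field K] [NumberField K]

/-! ### Jensen's count in the disc of radius `31/16` -/

/-- `log 32 ≤ 5` (`32 = 2⁵`, `log 2 < 1`). [folklore] -/
theorem log_thirtyTwo_le_five : Real.log 32 ≤ 5 := by
  have h : Real.log 32 = 5 * Real.log 2 := by
    rw [show (32 : ℝ) = 2 ^ 5 by norm_num, Real.log_pow]; norm_num
  rw [h]
  have := Real.log_two_lt_d9
  linarith

/-- **Zeros of `ζ_K` in the disc `|s − (2 + it)| ≤ 31/16`** (Jensen; Lagarias–Odlyzko 1977,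
Lemma 5.4 in disc form): counted with multiplicity they number at most `32 M_K(t)`
(`log(32/31) ≥ 1/32`). [cite: LagariasOdlyzko1977, Lemma 5.4] -/
theorem sum_divisor_dedekindZeta₁_bigDisc_le (t : ℝ) :
    ∑ u ∈ ((divisor (dedekindZeta₁ K) (closedBall (2 + t * I) (31 / 16))).finiteSupport
        (isCompact_closedBall _ _)).toFinset,
      (divisor (dedekindZeta₁ K) (closedBall (2 + t * I) (31 / 16)) u : ℝ) ≤ 32 * discBound K t := by
  set D := divisor (dedekindZeta₁ K) (closedBall (2 + t * I) (31 / 16)) with hD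
  have hfin : (Function.support D).Finite := D.finiteSupport (isCompact_closedBall _ _)
  have hsum : ∑ u ∈ hfin.toFinset, (D u : ℝ) = ∑ᶠ u, (D u : ℝ) := by
    rw [finsum_eq_sum_of_support_subset (fun u => (D u : ℝ)) (s := hfin.toFinset) ?_]
    intro u hu
    simp only [Function.mem_support, ne_eq, Int.cast_eq_zero] at hu
    simpa using hu
  rw [hsum]
  have hJ := finsum_divisor_dedekindZeta₁_le K t (r := 31 / 16) (by norm_num) (by norm_num)
  refine hJ.trans ?_
  have hlog : 1 / 32 ≤ Real.log (2 / (31 / 16)) := by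
    have := Real.one_sub_inv_le_log_of_pos (x := 2 / (31 / 16)) (by norm_num)
    norm_num at this ⊢
    linarith
  have hM := discBound_nonneg K t
  rw [div_le_iff₀ (by linarith)]
  nlinarith

/-- The divisor of the entire function `ζ₁_K` on a disc is nonnegative. [folklore] -/
theorem divisor_dedekindZeta₁_nonneg (c : ℂ) (R : ℝ) (u : ℂ) :
    0 ≤ divisor (dedekindZeta₁ K) (closedBall c R) u :=
  (analyticOnNhd_dedekindZeta₁ K (closedBall c R)).divisor_nonneg u

variable {K} in
/-- A point of the support of the divisor of `ζ₁_K` on `|s − (2 + it)| ≤ 31/16` is a zero of `ζ₁_K`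
(equivalently of `ζ_K`) in that disc, with `1/16 ≤ Re ρ < 1` (no zeros on `Re s ≥ 1`). [folklore] -/
theorem zero_of_mem_support_divisor_bigDisc {t : ℝ} {u : ℂ}
    (hu : u ∈ ((divisor (dedekindZeta₁ K) (closedBall (2 + t * I) (31 / 16))).finiteSupport
        (isCompact_closedBall _ _)).toFinset) :
    dedekindZeta₁ K u = 0 ∧ u ∈ closedBall (2 + t * I) (31 / 16) ∧ 1 / 16 ≤ u.re ∧ u.re < 1 := by
  set c : ℂ := 2 + t * I with hc
  set D := divisor (dedekindZeta₁ K) (closedBall c (31 / 16)) with hD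
  rw [Set.Finite.mem_toFinset, Function.mem_support] at hu
  have huB : u ∈ closedBall c (31 / 16) := D.supportWithinDomain (Function.mem_support.2 hu)
  have hfu : dedekindZeta₁ K u = 0 := by
    have han := analyticOnNhd_dedekindZeta₁ K (closedBall c (31 / 16))
    rw [hD, divisor_apply han.meromorphicOn huB,
      ((dedekindZeta₁_differentiable K).analyticAt u).meromorphicOrderAt_eq] at hu
    by_contra hne
    apply hu
    rw [((dedekindZeta₁_differentiable K).analyticAt u).analyticOrderAt_eq_zero.2 hne]
    simp
  have hure : 1 / 16 ≤ u.re := by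
    rw [mem_closedBall, dist_eq_norm] at huB
    have := abs_re_le_norm (u - c)
    simp only [hc, sub_re, add_re, re_ofNat, mul_re, ofReal_re, I_re, mul_zero, ofReal_im, I_im,
      mul_one, sub_self, add_zero] at this
    have := (abs_le.mp (this.trans huB)).1
    linarith
  have hlt : u.re < 1 := by
    by_contra h
    exact dedekindZeta₁_ne_zero_of_one_le_re (not_lt.mp h) hfu
  exact ⟨hfu, huB, hure, hlt⟩

variable {K} in
/-- Under ERH for `K`, the zeros of `ζ₁_K` in `|s − (2 + it)| ≤ 31/16` lie on the critical line.
[folklore] -/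
theorem re_eq_one_half_of_mem_support_of_erh (hERH : NumberField.ExtendedRiemannHypothesis K)
    {t : ℝ} {u : ℂ}
    (hu : u ∈ ((divisor (dedekindZeta₁ K) (closedBall (2 + t * I) (31 / 16))).finiteSupport
        (isCompact_closedBall _ _)).toFinset) :
    u.re = 1 / 2 := by
  obtain ⟨hfu, -, hure, -⟩ := zero_of_mem_support_divisor_bigDisc hu
  exact re_eq_one_half_of_erh hERH hfu (by linarith)

/-! ### The local partial fraction -/

/-- **The local partial fraction of `ζ₁_K'/ζ₁_K`, uniformly in `K`** (Lagarias–Odlyzko 1977,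
Lemma 5.6, disc form): for real `t` and `|s − (2 + it)| ≤ 7/4` with `ζ₁_K(s) ≠ 0`,
`|ζ₁_K'/ζ₁_K(s) − ∑_ρ m(ρ)/(s − ρ)| ≤ 77760 · M_K(t)`, where `ρ` runs over the zeros of `ζ₁_K` in
`|ρ − (2 + it)| ≤ 31/16` with multiplicities `m(ρ)` (Mathlib's `divisor`) and
`M_K(t) = log|d_K| + 3n_K + (n_K + 1) log(|t| + 7)`. (Landau's lemma with radii `7/4, 15/8, 31/16, 2`:
`2r₁/((R₂−r₁)(r₁−r)) = 480`, `log(B/|ζ₁_K(2+it)|) ≤ M_K(t)`, `N ≤ 32 M_K(t)`, `log 32 ≤ 5`.)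
[cite: LagariasOdlyzko1977, Lemma 5.6] -/
theorem norm_logDeriv_dedekindZeta₁_sub_sum_le (t : ℝ) {s : ℂ}
    (hs : s ∈ closedBall (2 + t * I) (7 / 4)) (hfs : dedekindZeta₁ K s ≠ 0) :
    ‖logDeriv (dedekindZeta₁ K) s -
        ∑ u ∈ ((divisor (dedekindZeta₁ K) (closedBall (2 + t * I) (31 / 16))).finiteSupport
            (isCompact_closedBall _ _)).toFinset,
          (divisor (dedekindZeta₁ K) (closedBall (2 + t * I) (31 / 16)) u : ℂ) / (s - u)‖ ≤
      77760 * discBound K t := by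
  classical
  set f := dedekindZeta₁ K with hf
  set c : ℂ := 2 + t * I with hc
  set B : ℝ := ((discr K).natAbs : ℝ) * Real.exp (2 * Module.finrank ℚ K) *
    (|t| + 7) ^ (Module.finrank ℚ K + 1) with hB
  set M : ℝ := discBound K t with hM
  have hM1 : 1 ≤ M := one_le_discBound K t
  have hc0 : f c ≠ 0 := dedekindZeta₁_ne_zero_of_one_le_re (by simp [hc])
  have h := Literature.Analysis.Complex.norm_logDeriv_sub_sum_le (f := f) (c := c)
    (r := 7 / 4) (r₁ := 15 / 8) (R₂ := 31 / 16) (R := 2) (B := B)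
    (by norm_num) (by norm_num) (by norm_num) (by norm_num)
    (analyticOnNhd_dedekindZeta₁ K _) hc0
    (fun z hz ↦ norm_dedekindZeta₁_le_of_mem_closedBall K t hz) hs hfs
  set D := divisor f (closedBall c (31 / 16)) with hD
  set S := (D.finiteSupport (isCompact_closedBall c (31 / 16))).toFinset with hS
  set N : ℝ := ∑ u ∈ S, (D u : ℝ) with hN
  have hN32 : N ≤ 32 * M := sum_divisor_dedekindZeta₁_bigDisc_le K t
  have hlog32 : Real.log (2 / (2 - 31 / 16)) ≤ 5 := by
    rw [show (2 : ℝ) / (2 - 31 / 16) = 32 by norm_num]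
    exact log_thirtyTwo_le_five
  have hlogB : Real.log (B / ‖f c‖) ≤ M := log_discSup_div_norm_le K t
  have hD0 : ∀ u, 0 ≤ D u := fun u ↦ (analyticOnNhd_dedekindZeta₁ K (closedBall c (31 / 16))).divisor_nonneg u
  have hN0 : 0 ≤ N := Finset.sum_nonneg fun u _ ↦ by exact_mod_cast hD0 u
  refine h.trans ?_
  have hK : 2 * (15 / 8 : ℝ) / ((31 / 16 - 15 / 8) * (15 / 8 - 7 / 4)) = 480 := by norm_num
  rw [hK]
  have h1 : N * Real.log (2 / (2 - 31 / 16)) ≤ 32 * M * 5 :=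
    mul_le_mul hN32 hlog32 (Real.log_nonneg (by norm_num)) (by positivity)
  nlinarith

/-! ### Consequences under ERH -/

/-- The sum over the zeros, at distance `≥ η` from all of them: `‖∑ m(ρ)/(s − ρ)‖ ≤ N/η`.
[folklore] -/
theorem norm_sum_divisor_div_le {t η : ℝ} (hη : 0 < η) {s : ℂ}
    (hdist : ∀ u ∈ ((divisor (dedekindZeta₁ K) (closedBall (2 + t * I) (31 / 16))).finiteSupport
        (isCompact_closedBall _ _)).toFinset, η ≤ ‖s - u‖) :
    ‖∑ u ∈ ((divisor (dedekindZeta₁ K) (closedBall (2 + t * I) (31 / 16))).finiteSupport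
            (isCompact_closedBall _ _)).toFinset,
          (divisor (dedekindZeta₁ K) (closedBall (2 + t * I) (31 / 16)) u : ℂ) / (s - u)‖ ≤
      32 * discBound K t / η := by
  set D := divisor (dedekindZeta₁ K) (closedBall (2 + t * I) (31 / 16)) with hD
  set S := (D.finiteSupport (isCompact_closedBall _ _)).toFinset with hS
  have hD0 : ∀ u, 0 ≤ D u := fun u ↦ divisor_dedekindZeta₁_nonneg K _ _ u
  calc ‖∑ u ∈ S, (D u : ℂ) / (s - u)‖ ≤ ∑ u ∈ S, ‖(D u : ℂ) / (s - u)‖ := norm_sum_le _ _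
    _ ≤ ∑ u ∈ S, (D u : ℝ) / η := by
        refine Finset.sum_le_sum fun u hu ↦ ?_
        rw [norm_div, Complex.norm_intCast, abs_of_nonneg (by exact_mod_cast hD0 u)]
        by_cases hDu : (D u : ℝ) = 0
        · rw [hDu, zero_div, zero_div]
        · exact div_le_div_of_nonneg_left (by exact_mod_cast hD0 u) hη (hdist u hu)
    _ = (∑ u ∈ S, (D u : ℝ)) / η := by rw [Finset.sum_div]
    _ ≤ 32 * discBound K t / η :=
        div_le_div_of_nonneg_right (sum_divisor_dedekindZeta₁_bigDisc_le K t) hη.le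

/-- **`ζ₁_K'/ζ₁_K` off the critical line under ERH** (cf. Lagarias–Odlyzko 1977, Lemma 5.6): assume
ERH for `K`; let `η > 0`, `|s − (2 + it)| ≤ 7/4` and `|Re s − 1/2| ≥ η`. Then
`|ζ₁_K'/ζ₁_K(s)| ≤ (32/η + 77760) M_K(t)` (the zeros in the partial fraction have `Re ρ = 1/2`).
[cite: LagariasOdlyzko1977, Lemma 5.6] -/
theorem norm_logDeriv_dedekindZeta₁_le_of_erh_of_dist (hERH : NumberField.ExtendedRiemannHypothesis K)
    {η : ℝ} (hη : 0 < η) (t : ℝ) {s : ℂ} (hs : s ∈ closedBall (2 + t * I) (7 / 4))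
    (hsre : η ≤ |s.re - 1 / 2|) :
    ‖logDeriv (dedekindZeta₁ K) s‖ ≤ (32 / η + 77760) * discBound K t := by
  set D := divisor (dedekindZeta₁ K) (closedBall (2 + t * I) (31 / 16)) with hD
  set S := (D.finiteSupport (isCompact_closedBall _ _)).toFinset with hS
  have hfs : dedekindZeta₁ K s ≠ 0 := by
    intro h0
    have hsre0 : 0 < s.re := by
      rw [mem_closedBall, dist_eq_norm] at hs
      have := abs_re_le_norm (s - (2 + t * I))
      simp only [sub_re, add_re, re_ofNat, mul_re, ofReal_re, I_re, mul_zero, ofReal_im, I_im,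
        mul_one, sub_self, add_zero] at this
      have := (abs_le.mp (this.trans hs)).1
      linarith
    have h12 := re_eq_one_half_of_erh hERH h0 hsre0
    rw [h12, sub_self, abs_zero] at hsre
    linarith
  have hdist : ∀ u ∈ S, η ≤ ‖s - u‖ := by
    intro u hu
    have hure : u.re = 1 / 2 := re_eq_one_half_of_mem_support_of_erh hERH hu
    calc η ≤ |s.re - 1 / 2| := hsre
      _ = |(s - u).re| := by rw [sub_re, hure]
      _ ≤ ‖s - u‖ := abs_re_le_norm _
  have h1 := norm_logDeriv_dedekindZeta₁_sub_sum_le K t hs hfs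
  have h2 := norm_sum_divisor_div_le K hη hdist
  have htri : ‖logDeriv (dedekindZeta₁ K) s‖ ≤ ‖∑ u ∈ S, (D u : ℂ) / (s - u)‖ +
      ‖logDeriv (dedekindZeta₁ K) s - ∑ u ∈ S, (D u : ℂ) / (s - u)‖ := by
    have := norm_add_le (∑ u ∈ S, (D u : ℂ) / (s - u))
      (logDeriv (dedekindZeta₁ K) s - ∑ u ∈ S, (D u : ℂ) / (s - u))
    rwa [add_sub_cancel] at this
  calc ‖logDeriv (dedekindZeta₁ K) s‖ ≤ 32 * discBound K t / η + 77760 * discBound K t :=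
        htri.trans (add_le_add h2 h1)
    _ = (32 / η + 77760) * discBound K t := by ring

/-- **The left edge under ERH**: `|ζ₁_K'/ζ₁_K(1/4 + it)| ≤ 77888 · M_K(t)` for every real `t`
(`η = 1/4`; `|1/4 + it − (2 + it)| = 7/4`). [cite: LagariasOdlyzko1977, Lemma 5.6] -/
theorem norm_logDeriv_dedekindZeta₁_quarter_le_of_erh (hERH : NumberField.ExtendedRiemannHypothesis K)
    (t : ℝ) : ‖logDeriv (dedekindZeta₁ K) (1 / 4 + t * I)‖ ≤ 77888 * discBound K t := by
  have hs : (1 / 4 + t * I : ℂ) ∈ closedBall (2 + t * I) (7 / 4) := by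
    rw [mem_closedBall, dist_eq_norm,
      show (1 / 4 + t * I : ℂ) - (2 + t * I) = ((-(7 / 4) : ℝ) : ℂ) by push_cast; ring,
      norm_real, Real.norm_eq_abs, abs_neg, abs_of_pos (by norm_num)]
  have hre : (1 / 4 : ℝ) ≤ |(1 / 4 + t * I : ℂ).re - 1 / 2| := by
    have : (1 / 4 + t * I : ℂ).re = 1 / 4 := by simp
    rw [this]; norm_num
  have h := norm_logDeriv_dedekindZeta₁_le_of_erh_of_dist K hERH (by norm_num : (0 : ℝ) < 1 / 4)
    t hs hre
  norm_num at h
  exact h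

end Literature.NumberTheory.LFunctions

end
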